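import Summits.Ventures.CertifiedArithmetic.LowPrec.EnvelopesE2M1

/-!
# Exhaustive error envelopes of FP6 `E3M2` products and sums under RNE

HONEST FRAMING (venture CertifiedArithmetic / cell `pub-lowprec`): certified error envelopes and
provably optimal rounding/accumulation schemes for low-precision formats under stated cost models;
every table by two implementations; no hardware or vendor claims.

OCP MX FP6 `E3M2` (2 mantissa bits, bias 3, max 28). Same vocabulary and method as `EnvelopesE2M1.lean` (`envTest`, `relTest`, `countPairs`;
every statement closed by `decide +kernel` over all `64²` ordered pairs; implementation A is the
cell's independent enumerator).
-/

namespace Summit.Ventures.CertifiedArithmetic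

open Literature.ComputerArithmetic.FloatingPoint
open Literature.ComputerArithmetic.FloatingPoint.MiniFloat
open Literature.ComputerArithmetic.FloatingPoint.Format

/-! ### FP6 `E3M2` (64 data, 4096 ordered pairs) -/

/-- `E3M2` PRODUCTS, absolute envelope: for `|ab| ≤ 28`, `|fl(ab) - ab|` is at most half the
spacing of the result binade: `[1/32, 1/32, 1/16, 1/8, 1/4, 1/2, 1, 2][E]`. -/
theorem E3M2_mul_abs_envelope (a b : MiniFloat E3M2) (h : |a.toRat * b.toRat| ≤ E3M2.maxRat) :
    |errMul E3M2 a b| ≤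
      [1/32, 1/32, 1/16, 1/8, 1/4, 1/2, 1, 2].getD (roundNE E3M2 (a.toRat * b.toRat)).expCode 0 := by
  have := forall₂_of_all_all (P := envTest E3M2 (· * ·) [1/32, 1/32, 1/16, 1/8, 1/4, 1/2, 1, 2])
    (by decide +kernel) a b
  exact of_decide_eq_true this h

/-- `E3M2` PRODUCTS, attained in the top binade: `3/4 · 24 = 18 ↦ 16`, error `2`. -/
theorem E3M2_mul_abs_envelope_attained :
    ∃ a b : MiniFloat E3M2, |a.toRat * b.toRat| ≤ E3M2.maxRat ∧ |errMul E3M2 a b| = 2 :=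
  ⟨⟨false, 2, 2, by decide, by decide, by decide⟩, ⟨false, 7, 2, by decide, by decide, by decide⟩,
    by decide +kernel⟩

/-- `E3M2` PRODUCTS, relative envelope in range: `|fl(ab) - ab| ≤ |ab|` (constant `1`, attained by
ties to zero in the subnormal range, e.g. `1/16 · 1/2 = 1/32 ↦ 0`). -/
theorem E3M2_mul_rel_envelope (a b : MiniFloat E3M2) (h : |a.toRat * b.toRat| ≤ E3M2.maxRat)
    (h0 : a.toRat * b.toRat ≠ 0) : |errMul E3M2 a b| ≤ 1 * |a.toRat * b.toRat| := by
  have := forall₂_of_all_all (P := relTest E3M2 (· * ·) 1) (by decide +kernel) a b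
  exact of_decide_eq_true this h h0

/-- `E3M2` SUMS, absolute envelope: `[0, 0, 1/16, 1/8, 1/4, 1/2, 1, 2][E]` — sums landing below
`1/2` (codes 0, 1) are exact. -/
theorem E3M2_add_abs_envelope (a b : MiniFloat E3M2) (h : |a.toRat + b.toRat| ≤ E3M2.maxRat) :
    |errAdd E3M2 a b| ≤
      [0, 0, 1/16, 1/8, 1/4, 1/2, 1, 2].getD (roundNE E3M2 (a.toRat + b.toRat)).expCode 0 := by
  have := forall₂_of_all_all (P := envTest E3M2 (· + ·) [0, 0, 1/16, 1/8, 1/4, 1/2, 1, 2])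
    (by decide +kernel) a b
  exact of_decide_eq_true this h

/-- `E3M2` SUMS, attained: `2 + 16 = 18 ↦ 16`, error `2`. -/
theorem E3M2_add_abs_envelope_attained :
    ∃ a b : MiniFloat E3M2, |a.toRat + b.toRat| ≤ E3M2.maxRat ∧ |errAdd E3M2 a b| = 2 :=
  ⟨⟨false, 4, 0, by decide, by decide, by decide⟩, ⟨false, 7, 0, by decide, by decide, by decide⟩,
    by decide +kernel⟩

/-- `E3M2` SUMS, relative envelope: `|fl(a+b) - (a+b)| ≤ |a+b| / 9`, the sharp constant `u/(1+u)`
with `u = 1/8`; attained at `2 + 16 = 18 ↦ 16`. -/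
theorem E3M2_add_rel_envelope (a b : MiniFloat E3M2) (h : |a.toRat + b.toRat| ≤ E3M2.maxRat)
    (h0 : a.toRat + b.toRat ≠ 0) : |errAdd E3M2 a b| ≤ 1 / 9 * |a.toRat + b.toRat| := by
  have := forall₂_of_all_all (P := relTest E3M2 (· + ·) (1 / 9)) (by decide +kernel) a b
  exact of_decide_eq_true this h h0

/-- `E3M2` COUNTS: of the 4096 ordered pairs, 1600 products and 1448 sums are exact; 800 products
and 184 sums overflow (`|a ∘ b| > 28`). -/
theorem E3M2_counts :
    countPairs E3M2 (fun a b => decide (errMul E3M2 a b = 0)) = 1600 ∧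
    countPairs E3M2 (fun a b => decide (errAdd E3M2 a b = 0)) = 1448 ∧
    countPairs E3M2 (fun a b => decide (E3M2.maxRat < |a.toRat * b.toRat|)) = 800 ∧
    countPairs E3M2 (fun a b => decide (E3M2.maxRat < |a.toRat + b.toRat|)) = 184 := by
  decide +kernel

end Summit.Ventures.CertifiedArithmetic
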